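import Summits.ResolutionOfSingularities.ResolutionOfSingularities.Theorems.HilbertSamuelEliminationSigmaMaxModificationsCorridor3WLadderIsoTailsArcLimitLayers
import HarnessLib

/-!
# [OURS · L1 W4.2 · D14 ROUTE G v2 «ARC LIMIT» · G0 FRAME STACK AT GENERAL `d`, file 1] Series in `t`, the translated chart
# step and the shear in `K⟦t, y_1, …, y_d⟧`
# (crux `SigmaMaxModifications` stmt-ResolutionOfSingularities-18506 / conjunct stmt-…-19249; line `w_ladder` v8.3; kernel K1
# `IsoFreeRationalTailsImpossible` in EVERY embedding dimension; `--supports stmt-ResolutionOfSingularities-19249`, helper)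

OURS (cell `res-hironaka`, slot ★L-G4 W4.2; hand res-type-071, object G0-L of res-L1-w42-lead-1's memo `ROUTE-G-ARCLIMIT.md`
sha16 `96c77a196e17bc23` §4 «G0 FRAME STACK AT GENERAL d (mechanical): `Series.transChartSubst/shearSubst/tSeries` (p521756) … from
`Fin 4` to `Fin (d+1)`»). This file is the VERBATIM re-typing at `MvPowerSeries (Fin (d + 1)) K` (`t = X 0`, `y_i = X i`, `i ≠ 0`; the
convention of the G2c files `…IsoTailsArcLimitDegree` / `…IsoTailsArcLimitLayers`, whose `ArcLimit.scale d K n` is the `n`-fold chart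
substitution) of the substitution vocabulary of lead-1's `…IsoTailsArcTranslated` (p521756, `d = 3`), under the NEW namespace `SeriesGen`
(same declaration names, so that the `d = 3` consumers port by renaming):

* `IsPureT`, `tSeries f = Σ_{k ≥ 1} f k · t^k`, `coeff_tSeries`, `constantCoeff_tSeries`, `tSeries_congr/_add/_neg`,
  `X_mul_tSeries_add_C_mul_X`, `subst_tSeries_of_apply_zero`;
* `transChartSubst c` (`t ↦ t`, `y_i ↦ t·y_i + c_i·t`), `shearSubst b` (`y_i ↦ y_i + Σ_k b_{k,i} t^k`), `hasSubst_*`, `*_apply_*`;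
* **`subst_chart_subst_shear`** — shearing conjugates the translated step into the plain chart step `ArcLimit.scale d K 1`
  (the substitution-level identity behind G2b «composite of translated charts = shear⁻¹ ∘ scale ∘ shear»), `subst_shear_neg_subst_shear`.

NOT re-typed here: the hypersurface arc lemma `Series.mem_pow_of_translatedStrictTransforms` (ROUTE H only; ROUTE G replaces it by the
limit inequality G2c). NOT a statement of H. Hironaka's manuscript [Hironaka2017] nor of [CossartJannsenSaito2020] / [CossartPiltant2009];
elementary coefficient algebra over any commutative ring `K`; AI-written, weaker than expert review.

## References
* V. Cossart, O. Piltant, J. Algebra 321 (2009), ch. 3 I.9 (formal arcs). [CossartPiltant2009]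
-/

set_option linter.dupNamespace false -- mandated namespace of this single-conjunct summit
open MvPowerSeries
open Finsupp hiding some

noncomputable section

namespace Summit.ResolutionOfSingularities.ResolutionOfSingularities.Cruxes.SigmaMaxModifications.IdeasL1C5

universe u

namespace SeriesGen

variable {d : ℕ} {K : Type u} [CommRing K]

/-! ### Series in `t` alone -/

/-- «pure `t`-power»: the exponent `e` involves only the variable `t` (index `0`). [folklore] -/
def IsPureT (e : Fin (d + 1) →₀ ℕ) : Prop := ∀ i, i ≠ 0 → e i = 0

/-- A pure `t`-exponent is `single 0 (e 0)`. [folklore] -/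
theorem isPureT_iff_eq_single (e : Fin (d + 1) →₀ ℕ) : IsPureT e ↔ e = Finsupp.single 0 (e 0) := by
  constructor
  · intro h
    ext i
    by_cases hi : i = 0
    · subst hi; simp
    · rw [h i hi, Finsupp.single_apply, if_neg (Ne.symm hi)]
  · intro h i hi
    rw [h, Finsupp.single_apply, if_neg (Ne.symm hi)]

/-- `single 0 k` is a pure `t`-exponent. [folklore] -/
theorem isPureT_single (k : ℕ) : IsPureT (Finsupp.single (0 : Fin (d + 1)) k) := fun i hi => by
  rw [Finsupp.single_apply, if_neg (Ne.symm hi)]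

open Classical in
/-- The series `Σ_{k ≥ 1} f k · t^k` in `K⟦t, y_1, …, y_d⟧` (no constant term; `f 0` is not read). [folklore] -/
def tSeries (f : ℕ → K) : MvPowerSeries (Fin (d + 1)) K :=
  fun e => if IsPureT e ∧ 0 < e 0 then f (e 0) else 0

open Classical in
/-- Unfolding the coefficients of `tSeries`. [folklore] -/
theorem coeff_tSeries (f : ℕ → K) (e : Fin (d + 1) →₀ ℕ) :
    coeff e (tSeries f : MvPowerSeries (Fin (d + 1)) K) = if IsPureT e ∧ 0 < e 0 then f (e 0) else 0 :=
  rfl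

/-- `tSeries f` has no constant term. [folklore] -/
theorem constantCoeff_tSeries (f : ℕ → K) : constantCoeff (tSeries f : MvPowerSeries (Fin (d + 1)) K) = 0 := by
  rw [← coeff_zero_eq_constantCoeff_apply, coeff_tSeries, if_neg]
  simp

/-- `tSeries f` only reads `f k` for `k ≥ 1`. [folklore] -/
theorem tSeries_congr {f f' : ℕ → K} (h : ∀ k, 0 < k → f k = f' k) :
    (tSeries f : MvPowerSeries (Fin (d + 1)) K) = tSeries f' := by
  ext e
  simp only [coeff_tSeries]
  split_ifs with he
  · exact h _ he.2
  · rfl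

/-- Additivity of `tSeries`. [folklore] -/
theorem tSeries_add (f f' : ℕ → K) : (tSeries f : MvPowerSeries (Fin (d + 1)) K) + tSeries f' = tSeries (f + f') := by
  ext e
  simp only [map_add, coeff_tSeries, Pi.add_apply]
  split_ifs <;> simp

/-- `tSeries (−f) = −tSeries f`. [folklore] -/
theorem tSeries_neg (f : ℕ → K) : (tSeries (-f) : MvPowerSeries (Fin (d + 1)) K) = -tSeries f := by
  ext e
  simp only [map_neg, coeff_tSeries, Pi.neg_apply]
  split_ifs <;> simp

/-- `t · (Σ_{k≥1} f k t^k) + c · t = Σ_{k≥1} f′ k t^k` with `f′ 1 = c`, `f′ (k+1) = f k`. [folklore] -/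
theorem X_mul_tSeries_add_C_mul_X (f : ℕ → K) (c : K) :
    (X 0 : MvPowerSeries (Fin (d + 1)) K) * tSeries f + C c * X 0 = tSeries (fun k => if k = 1 then c else f (k - 1)) := by
  ext e
  have hX1 : (X 0 : MvPowerSeries (Fin (d + 1)) K) = monomial (Finsupp.single 0 1) 1 := by
    rw [← X_pow_eq (0 : Fin (d + 1)) 1, pow_one]
  rw [map_add, hX1, coeff_monomial_mul, one_mul, coeff_C_mul, coeff_monomial, coeff_tSeries, coeff_tSeries]
  by_cases hp : IsPureT e
  · have hp' : IsPureT (e - Finsupp.single 0 1) := fun i hi => by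
      rw [Finsupp.tsub_apply, hp i hi, zero_tsub]
    have hle : Finsupp.single (0 : Fin (d + 1)) 1 ≤ e ↔ 1 ≤ e 0 := Finsupp.single_le_iff
    have heq : (e = Finsupp.single 0 1) ↔ e 0 = 1 := by
      constructor
      · intro h; rw [h]; simp
      · intro h; rw [(isPureT_iff_eq_single e).mp hp, h]
    simp only [hp', true_and, hp, heq, Finsupp.coe_tsub, Pi.sub_apply, Finsupp.single_eq_same, hle]
    set k := e 0 with hk
    by_cases h0 : k = 0
    · simp [h0]
    by_cases h1 : k = 1
    · simp [h1]
    have h2 : 2 ≤ k := by omega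
    rw [if_pos (by omega), if_pos (by omega), if_neg h1, if_pos (by omega), if_neg h1]
    simp
  · -- not a pure `t`-power: every term vanishes
    have hp' : ¬ IsPureT (e - Finsupp.single 0 1) := by
      intro h; apply hp
      intro i hi
      have := h i hi
      rwa [Finsupp.tsub_apply, Finsupp.single_apply, if_neg (Ne.symm hi), tsub_zero] at this
    have hne : e ≠ Finsupp.single 0 1 := fun h => hp (h ▸ isPureT_single 1)
    simp [hp, hp', hne]

/-- Substituting a family that fixes `t` into a series in `t` alone does nothing. [folklore] -/
theorem subst_tSeries_of_apply_zero {a : Fin (d + 1) → MvPowerSeries (Fin (d + 1)) K} (ha : HasSubst a) (h0 : a 0 = X 0)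
    (f : ℕ → K) : subst a (tSeries f : MvPowerSeries (Fin (d + 1)) K) = tSeries f := by
  ext e
  rw [coeff_subst ha]
  -- only pure-`t` exponents `d` with `d 0 > 0` contribute, and then `∏ (a i)^{d i} = t^{d 0} = monomial d 1`
  have hprod : ∀ d' : Fin (d + 1) →₀ ℕ, IsPureT d' → (d'.prod fun i k => a i ^ k) = monomial d' (1 : K) := by
    intro d' hd
    rw [(isPureT_iff_eq_single d').mp hd, Finsupp.prod_single_index (by simp), h0, X_pow_eq]
  by_cases he : IsPureT e ∧ 0 < e 0
  · rw [finsum_eq_single _ e]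
    · rw [hprod e he.1, coeff_monomial_same, coeff_tSeries, if_pos he, smul_eq_mul, mul_one]
    · intro d' hd
      rw [coeff_tSeries]
      split_ifs with hd'
      · rw [hprod d' hd'.1, coeff_monomial, if_neg (Ne.symm hd), smul_zero]
      · rw [zero_smul]
  · rw [coeff_tSeries, if_neg he]
    apply finsum_eq_zero_of_forall_eq_zero
    intro d'
    rw [coeff_tSeries]
    split_ifs with hd'
    · rw [hprod d' hd'.1, coeff_monomial, if_neg, smul_zero]
      rintro rfl
      exact he hd'
    · rw [zero_smul]

/-! ### The translated chart step and the shear -/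

/-- The FREE-RATIONAL step: the `t`-chart followed by the `κ`-rational translation `c`: `t ↦ t`, `y_i ↦ t·y_i + c_i·t`
(`i ≠ 0`; `c 0` is not read). [folklore] -/
def transChartSubst (c : Fin (d + 1) → K) : Fin (d + 1) → MvPowerSeries (Fin (d + 1)) K :=
  fun i => if i = 0 then X 0 else X 0 * X i + C (c i) * X 0

/-- The SHEAR along the arc: `t ↦ t`, `y_i ↦ y_i + Σ_{k≥1} b k i · t^k`. [folklore] -/
def shearSubst (b : ℕ → Fin (d + 1) → K) : Fin (d + 1) → MvPowerSeries (Fin (d + 1)) K :=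
  fun i => if i = 0 then X 0 else X i + tSeries (fun k => b k i)

/-- The translated chart family can be substituted (zero constant terms). [folklore] -/
theorem hasSubst_transChartSubst (c : Fin (d + 1) → K) : HasSubst (transChartSubst c) :=
  hasSubst_of_constantCoeff_zero fun i => by
    unfold transChartSubst
    split_ifs <;> simp

/-- The shear family can be substituted (zero constant terms). [folklore] -/
theorem hasSubst_shearSubst (b : ℕ → Fin (d + 1) → K) : HasSubst (shearSubst b) :=
  hasSubst_of_constantCoeff_zero fun i => by
    unfold shearSubst
    split_ifs <;> simp [constantCoeff_tSeries]

/-- `t ↦ t`. [folklore] -/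
theorem transChartSubst_apply_zero (c : Fin (d + 1) → K) : transChartSubst c 0 = X 0 := by simp [transChartSubst]

/-- `y_i ↦ t y_i + c_i t`. [folklore] -/
theorem transChartSubst_apply_of_ne (c : Fin (d + 1) → K) {i : Fin (d + 1)} (hi : i ≠ 0) :
    transChartSubst c i = X 0 * X i + C (c i) * X 0 := by simp [transChartSubst, hi]

/-- `t ↦ t`. [folklore] -/
theorem shearSubst_apply_zero (b : ℕ → Fin (d + 1) → K) : shearSubst b 0 = X 0 := by simp [shearSubst]

/-- `y_i ↦ y_i + Σ_k b_{k,i} t^k`. [folklore] -/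
theorem shearSubst_apply_of_ne (b : ℕ → Fin (d + 1) → K) {i : Fin (d + 1)} (hi : i ≠ 0) :
    shearSubst b i = X i + tSeries (fun k => b k i) := by simp [shearSubst, hi]

/-- The translation vanishes on `t`: `transChartSubst c` with `c = 0` off `0` is the plain chart step `ArcLimit.scale d K 1`. [folklore] -/
theorem transChartSubst_eq_scale_of_forall_eq_zero {c : Fin (d + 1) → K} (hc : ∀ i, i ≠ 0 → c i = 0) :
    transChartSubst c = ArcLimit.scale d K 1 := by
  funext i
  by_cases hi : i = 0
  · subst hi; rw [transChartSubst_apply_zero, ArcLimit.scale_zero_apply]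
  · rw [transChartSubst_apply_of_ne _ hi, ArcLimit.scale_apply_of_ne_zero _ hi, hc i hi, map_zero, zero_mul, add_zero,
      pow_one]

/-- **Shearing conjugates the translated step into the plain chart step** `ArcLimit.scale d K 1`: with `θ_j = shear (k ↦ a (j+k))`,
`subst scale₁ (subst θ_j g) = subst θ_{j+1} (subst (transChart (a (j+1))) g)`. [folklore] -/
theorem subst_chart_subst_shear (a : ℕ → Fin (d + 1) → K) (j : ℕ) (g : MvPowerSeries (Fin (d + 1)) K) :
    subst (ArcLimit.scale d K 1) (subst (shearSubst fun k => a (j + k)) g) =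
      subst (shearSubst fun k => a (j + 1 + k)) (subst (transChartSubst (a (j + 1))) g) := by
  rw [subst_comp_subst_apply (hasSubst_shearSubst _) (ArcLimit.hasSubst_scale 1),
    subst_comp_subst_apply (hasSubst_transChartSubst _) (hasSubst_shearSubst _)]
  congr 1
  funext i
  by_cases hi : i = 0
  · subst hi
    rw [shearSubst_apply_zero, transChartSubst_apply_zero, subst_X (ArcLimit.hasSubst_scale 1),
      subst_X (hasSubst_shearSubst _), ArcLimit.scale_zero_apply, shearSubst_apply_zero]
  · rw [shearSubst_apply_of_ne _ hi, transChartSubst_apply_of_ne _ hi,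
      subst_add (ArcLimit.hasSubst_scale 1), subst_X (ArcLimit.hasSubst_scale 1),
      ArcLimit.scale_apply_of_ne_zero _ hi, pow_one,
      subst_tSeries_of_apply_zero (ArcLimit.hasSubst_scale 1) (ArcLimit.scale_zero_apply 1),
      subst_add (hasSubst_shearSubst _), subst_mul (hasSubst_shearSubst _), subst_mul (hasSubst_shearSubst _),
      subst_X (hasSubst_shearSubst _), subst_X (hasSubst_shearSubst _), subst_C,
      shearSubst_apply_zero, shearSubst_apply_of_ne _ hi, mul_add, add_assoc, X_mul_tSeries_add_C_mul_X]
    congr 1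
    apply tSeries_congr
    intro k hk
    by_cases h1 : k = 1
    · subst h1; simp
    · rw [if_neg h1]; congr 1; omega

/-- Shear followed by the opposite shear is the identity. [folklore] -/
theorem subst_shear_neg_subst_shear (b : ℕ → Fin (d + 1) → K) (g : MvPowerSeries (Fin (d + 1)) K) :
    subst (shearSubst fun k i => -b k i) (subst (shearSubst b) g) = g := by
  rw [subst_comp_subst_apply (hasSubst_shearSubst _) (hasSubst_shearSubst _)]
  have : (fun i => subst (shearSubst fun k i => -b k i) (shearSubst b i)) = MvPowerSeries.X := by
    funext i
    by_cases hi : i = 0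
    · subst hi
      rw [shearSubst_apply_zero, subst_X (hasSubst_shearSubst _), shearSubst_apply_zero]
    · rw [shearSubst_apply_of_ne _ hi, subst_add (hasSubst_shearSubst _), subst_X (hasSubst_shearSubst _),
        subst_tSeries_of_apply_zero (hasSubst_shearSubst _) (shearSubst_apply_zero _), shearSubst_apply_of_ne _ hi,
        add_assoc, tSeries_add]
      have h0 : ((fun k => -b k i) + fun k => b k i) = 0 := by funext k; simp
      rw [h0]
      simp [MvPowerSeries.ext_iff, coeff_tSeries]
  rw [this, subst_self]; rfl

/-- The opposite shear followed by the shear is the identity. [folklore] -/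
theorem subst_shear_subst_shear_neg (b : ℕ → Fin (d + 1) → K) (g : MvPowerSeries (Fin (d + 1)) K) :
    subst (shearSubst b) (subst (shearSubst fun k i => -b k i) g) = g := by
  have h := subst_shear_neg_subst_shear (fun k i => -b k i) g
  simp only [neg_neg] at h
  exact h

end SeriesGen

end Summit.ResolutionOfSingularities.ResolutionOfSingularities.Cruxes.SigmaMaxModifications.IdeasL1C5

end
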